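import Summits.Ventures.CertifiedManyBodySolver.Observables.StiffnessApexTransportFan
import HarnessLib

/-!
# Ventures/CertifiedManyBodySolver — Observables/StiffnessApexTransportFanWedge.lean

HONEST FRAMING: one-sided certified CEILINGS on the uniform flux stiffness (t–t′ f-sum class) at half filling, transported from ONE solved
point to a WEDGE of its apex fan (the targets whose apex hopping `κ` is at least a given `κ₀`); conditional on the source rows named; a
ceiling never speaks to the presence of order; not a `T_c`, not a superconductivity verdict; no phase sentence. Zero compute, no definition,
no claim node, no `sorry`.

Cell `pub/hubbard-downfold` (D-0150 L-DF2), seat `hubbard-downfold-unc-2` (`prover-hubbard-downfold-unc-2-g16-0`); a coordinate form of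
`Observables/StiffnessApexTransportFan.lean` §2. The level sets of `κ(t′, U) = (U t′_A − U_A t′)/(U − U_A)` are the straight LINES through the
source `(t′_A, U_A)` (the line to `(κ, 0)`), so the natural tiles of a fan are WEDGES `{κ ≥ κ₀}` rather than rectangles: on the wedge
`{κ(t′,U) ≥ κ₀} ∩ {right of the apex curve}` the fan price is at most `max(2t′_A − κ₀, 0)·A/4` — ONE inequality, exact on the wedge's edge.
This is the shape in which a station corner's own word + its `K₂` word eat into the «segment fan» of that station (route CovLa214M2b, K1).

References: T. Koma, H. Tasaki, J. Stat. Phys. 76 (1994) 745, §1 [KomaTasaki1994]; D. J. Scalapino, S. R. White, S.-C. Zhang, PRB 47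
(1993) 7995, §II [ScalapinoWhiteZhang1993].
-/

noncomputable section

namespace Summit.Ventures.CertifiedManyBodySolver.Observables

open Literature.MathematicalPhysics.QuantumLattice
open Literature.MathematicalPhysics.QuantumLattice.ThermodynamicLimit
open Literature.MathematicalPhysics.QuantumFieldTheory
open Literature.Probability.LatticeModels
open Matrix Finset Filter Topology HubbardWave0
open scoped Matrix BigOperators ComplexOrder

variable {t'A UA : ℝ}

/-- **WEDGE LEAF (half filling).** A certified f-sum orbit row `r` at `(t′_A, U_A, 1)` (`U_A ≥ 0`, cap certified) and a ceiling `K₂ ≤ A` (`0 ≤ A ≤ a`,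
`−r ≤ w`) on the same class give `ObsStiffnessSeqCeilingAt t′ U 1 c` at every target with `U_A < U`, `t′ < 0`, right of the apex curve
(`t′_A U ≤ t′(2U − U_A)`) and IN THE WEDGE `κ(t′, U) ≥ κ₀`, i.e. `κ₀(U − U_A) ≤ U t′_A − U_A t′`, for every `c ≥ w + max(2t′_A − κ₀, 0)·a/4`.
[cite: KomaTasaki1994, §1] [cite: ScalapinoWhiteZhang1993, §II] -/
theorem ObsStiffnessSeqCeilingAt_halfFilling_on_apexWedge_of_fsumRow_of_diagHop_le_decimal (Uo : ℝ) (hUA : 0 ≤ UA) {u r : ℚ}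
    (hrow : SquareTTPrimeCorrOrbitLowerRow t'A UA 1 u r Finset.univ (box 2 7) (-oddMomentObsTT t'A Uo 0))
    (hu : energyDensityTT' 1 t'A UA 1 ≤ ((u : ℚ) : ℝ)) {A : ℝ} (hA0 : 0 ≤ A)
    (hA : ∀ (ω : InfVolFermionState 2) (Ls : ℕ → ℕ) (ψ : ∀ L, Fock (Orb (FermionTorus 2 L))),
      Tendsto Ls atTop atTop →
      (∀ j, IsGroundStateInSector (hubbardTorusTT' (Ls j) 1 t'A UA) (rectN 1 (Ls j)) 0 (ψ (Ls j))) →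
      (∀ j, star (ψ (Ls j)) ⬝ᵥ ψ (Ls j) = 1) → ω.IsTorusLimitOf ψ Ls →
      ω.meanEnergy (hubbardTTPrimeFermionInteraction 0 1 0) 1 ≤ A)
    {w a : ℝ} (hw : -((r : ℚ) : ℝ) ≤ w) (ha : A ≤ a)
    {t'P UP κ₀ : ℝ} (hU : UA < UP) (ht'P : t'P < 0) (h₂ : t'A * UP ≤ t'P * (2 * UP - UA))
    (hκ₀ : κ₀ * (UP - UA) ≤ UP * t'A - UA * t'P) (c : ℚ)
    (hc : w + max (2 * t'A - κ₀) 0 * a / 4 ≤ ((c : ℚ) : ℝ)) :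
    ObsStiffnessSeqCeilingAt t'P UP 1 c := by
  have hd : 0 < UP - UA := sub_pos.2 hU
  have ha0 : 0 ≤ a := hA0.trans ha
  have hκ : κ₀ ≤ (UP * t'A - UA * t'P) / (UP - UA) := by rwa [le_div_iff₀ hd]
  refine ObsStiffnessSeqCeilingAt_halfFilling_on_apexFan_of_fsumRow_of_diagHop_le_decimal Uo hUA hrow hu hA0 hA hw ha hU ht'P h₂ c ?_
  have hm : max (2 * t'A - (UP * t'A - UA * t'P) / (UP - UA)) 0 ≤ max (2 * t'A - κ₀) 0 := max_le_max (by linarith) le_rfl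
  have hle : max (2 * t'A - (UP * t'A - UA * t'P) / (UP - UA)) 0 * a / 4 ≤ max (2 * t'A - κ₀) 0 * a / 4 :=
    div_le_div_of_nonneg_right (mul_le_mul_of_nonneg_right hm ha0) (by norm_num)
  linarith

/-- **Wedge leaf in SLOPE form.** The two geometric hypotheses rewritten with `U > 0`: right of the curve ⇔ `t′_A ≤ t′(2 − U_A/U)`, and the wedge
`κ ≥ κ₀` ⇔ `κ₀(U − U_A) ≤ U t′_A − U_A t′` (kept). The first form is the binder of route CovLa214M2b's `SegmentFanCeiling` (`−3/10 ≤ t′(2 − (29/5)/U)`).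
[cite: KomaTasaki1994, §1] [cite: ScalapinoWhiteZhang1993, §II] -/
theorem ObsStiffnessSeqCeilingAt_halfFilling_on_apexWedge_of_fsumRow_of_diagHop_le_slope (Uo : ℝ) (hUA : 0 ≤ UA) {u r : ℚ}
    (hrow : SquareTTPrimeCorrOrbitLowerRow t'A UA 1 u r Finset.univ (box 2 7) (-oddMomentObsTT t'A Uo 0))
    (hu : energyDensityTT' 1 t'A UA 1 ≤ ((u : ℚ) : ℝ)) {A : ℝ} (hA0 : 0 ≤ A)
    (hA : ∀ (ω : InfVolFermionState 2) (Ls : ℕ → ℕ) (ψ : ∀ L, Fock (Orb (FermionTorus 2 L))),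
      Tendsto Ls atTop atTop →
      (∀ j, IsGroundStateInSector (hubbardTorusTT' (Ls j) 1 t'A UA) (rectN 1 (Ls j)) 0 (ψ (Ls j))) →
      (∀ j, star (ψ (Ls j)) ⬝ᵥ ψ (Ls j) = 1) → ω.IsTorusLimitOf ψ Ls →
      ω.meanEnergy (hubbardTTPrimeFermionInteraction 0 1 0) 1 ≤ A)
    {w a : ℝ} (hw : -((r : ℚ) : ℝ) ≤ w) (ha : A ≤ a)
    {t'P UP κ₀ : ℝ} (hU : UA < UP) (ht'P : t'P < 0) (hslope : t'A ≤ t'P * (2 - UA / UP))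
    (hκ₀ : κ₀ * (UP - UA) ≤ UP * t'A - UA * t'P) (c : ℚ)
    (hc : w + max (2 * t'A - κ₀) 0 * a / 4 ≤ ((c : ℚ) : ℝ)) :
    ObsStiffnessSeqCeilingAt t'P UP 1 c := by
  have hUP : 0 < UP := hUA.trans_lt hU
  refine ObsStiffnessSeqCeilingAt_halfFilling_on_apexWedge_of_fsumRow_of_diagHop_le_decimal Uo hUA hrow hu hA0 hA hw ha hU ht'P ?_
    hκ₀ c hc
  have e : t'P * (2 - UA / UP) * UP = t'P * (2 * UP - UA) := by field_simp
  nlinarith [mul_le_mul_of_nonneg_right hslope hUP.le]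

/-- **SLOT WEDGE LEAF (half filling, `t′_A < 0`).** A row `r` read at slot `σ` on the class at `(t′_A, U_A, 1)` (`U_A ≥ 0`, cap certified), a ceiling
`K₂ ≤ A` (`0 ≤ A ≤ a`, `−r ≤ w`): every target with `U_A < U`, `t′ < 0`, right of the apex curve and in the wedge `κ₀(U − U_A) ≤ U t′_A − U_A t′` carries
`ObsStiffnessSeqCeilingAt t′ U 1 c` for every `c ≥ w + max(2σ − κ₀, 0)·a/4`. (The corner-objective legs of the curtain plan word wedges of the box this way.)
[cite: KomaTasaki1994, §1] [cite: ScalapinoWhiteZhang1993, §II] -/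
theorem ObsStiffnessSeqCeilingAt_halfFilling_on_apexSlotWedge_of_slotRow_of_diagHop_le_decimal (Uo : ℝ) (hUA : 0 ≤ UA) (ht'A : t'A < 0)
    {σ : ℝ} {u r : ℚ} (hrow : SquareTTPrimeCorrOrbitLowerRow t'A UA 1 u r Finset.univ (box 2 7) (-oddMomentObsTT σ Uo 0))
    (hu : energyDensityTT' 1 t'A UA 1 ≤ ((u : ℚ) : ℝ)) {A : ℝ} (hA0 : 0 ≤ A)
    (hA : ∀ (ω : InfVolFermionState 2) (Ls : ℕ → ℕ) (ψ : ∀ L, Fock (Orb (FermionTorus 2 L))),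
      Tendsto Ls atTop atTop →
      (∀ j, IsGroundStateInSector (hubbardTorusTT' (Ls j) 1 t'A UA) (rectN 1 (Ls j)) 0 (ψ (Ls j))) →
      (∀ j, star (ψ (Ls j)) ⬝ᵥ ψ (Ls j) = 1) → ω.IsTorusLimitOf ψ Ls →
      ω.meanEnergy (hubbardTTPrimeFermionInteraction 0 1 0) 1 ≤ A)
    {w a : ℝ} (hw : -((r : ℚ) : ℝ) ≤ w) (ha : A ≤ a)
    {t'P UP κ₀ : ℝ} (hU : UA < UP) (ht'P : t'P < 0) (h₂ : t'A * UP ≤ t'P * (2 * UP - UA))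
    (hκ₀ : κ₀ * (UP - UA) ≤ UP * t'A - UA * t'P) (c : ℚ)
    (hc : w + max (2 * σ - κ₀) 0 * a / 4 ≤ ((c : ℚ) : ℝ)) :
    ObsStiffnessSeqCeilingAt t'P UP 1 c := by
  have hd : 0 < UP - UA := sub_pos.2 hU
  have ha0 : 0 ≤ a := hA0.trans ha
  have hκ : κ₀ ≤ (UP * t'A - UA * t'P) / (UP - UA) := by rwa [le_div_iff₀ hd]
  refine ObsStiffnessSeqCeilingAt_halfFilling_on_apexFan_of_slotRow_of_diagHop_le_decimal Uo hUA ht'A hrow hu hA0 hA hw ha hU ht'P h₂ c ?_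
  have hm : max (2 * σ - (UP * t'A - UA * t'P) / (UP - UA)) 0 ≤ max (2 * σ - κ₀) 0 := max_le_max (by linarith) le_rfl
  have hle : max (2 * σ - (UP * t'A - UA * t'P) / (UP - UA)) 0 * a / 4 ≤ max (2 * σ - κ₀) 0 * a / 4 :=
    div_le_div_of_nonneg_right (mul_le_mul_of_nonneg_right hm ha0) (by norm_num)
  linarith

end Summit.Ventures.CertifiedManyBodySolver.Observables

end
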